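import Summits.QuantumFields.BalabanUV.T4Continuum.Support.ApproxRefineMismatch
import Summits.QuantumFields.BalabanUV.T4Continuum.Support.SmoothRefineOfApprox
import HarnessLib

/-!
# T⁴ programme, node NE3 — kinematic refinement lemma, row R1-asm, part 2: THE ASSEMBLY OF LEAF R1
# `ApproxRefine d (sfClass d L N ε) L N b c b₁ c₁ m` FROM THE FILLED PRE-COMPENSATED CONFIGURATION — modulo the two
# regularity bounds of the filling (leaf-07's F3 ∘ leaf-01's flux-gradient transport), which enter as HYPOTHESES here

NE3 formalisation swarm `b2b-balaban-t4-ne3-formalise-*`, LEAF PROVER 09 (unit `b2b-balaban-t4-ne3-formalise-leaf-09`),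
row **R1-asm** (owner's RULING NE3-R1-ASSEMBLY, journal 2026-08-20T07:54:03Z): the END
`approxRefine_sfClass : ApproxRefine d (sfClass …) L N b c b₁ c₁ m` (socket NE3-R1 = `SmoothRefineOfApprox.ApproxRefine`,
p211841) composed BY NAME from the crew's leaves.

## This file: the END modulo the regularity of the filling (`approxRefine_of_fillBounds`)

For a level-`j` datum `U ∈ sfClass L N ε j` with `RegularSup d L N b c j U` put `T := precomp L U` (leaf-01, S4c) and
`W := fullFill L T (rootH L T)` (leaf-07 F2 over leaf-01's roots).  §1: `W` is unitary (`fullFill_mem`,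
`rootH_mem_unitary`, `isUnitaryCfg_precomp`), `(N·L^{j+1})`-periodic (`fullFill_add_period`, `rootH_add_period`,
`isPeriodicCfg_precomp`), and `T` is a `SkeletonDatum` with radius `(8d−7)·b(L^j)^{−2}` (`skeletonDatum_precomp`).  §2:
the covariant-gradient hypothesis of leaf-08's loop-log law in its `plaqLog` orientation follows from a `Plane`-oriented
pointwise bound on `covGrad W (flux W)` (`plaqLog_grad_le_of_covGrad`, via leaf-01's `norm_covGrad_mlog_le`).  §3
**`approxRefine_of_fillBounds`**: IF the filling of every such datum is a small field of radius `b₁(L^{j+1})^{−2}` with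
pointwise covariant flux gradients `≤ c₁(L^{j+1})^{−3}` (the two hypotheses `hfillS`, `hfillG` — exactly what leaf-07's
F3 bounds composed with leaf-01's `SkeletonPrecompGrad` deliver, with `b₁, c₁` polynomial in `d, L, b, c`), THEN
`ApproxRefine d (sfClass d L N ε) L N b c b₁ c₁ m` with the CLOSED mismatch constant
`m = 3·(1280·d(d+1)²(d+4)²·L²·b₁² + d(d+1)·c₁ + (d−1)²·(c + (37(d−1) + 4)·b²))`,
under the displayed `j`-uniform smallness conditions `(8d−7)b ≤ 1/16`, `(d−1)b ≤ 1/2`,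
`(d−1)c + 41(d−1)²b² ≤ 1/4`… (as hypotheses), by part 1 (`ApproxRefineMismatch.norm_sub_rescale_bavg_fullFill_le`,
`norm_X0_precomp_sub_X0_le`) and leaf-08's `BlockAverageLoopLogCore.norm_Xavg_sub_Xfirst_le` (E1).
The unconditional END `approxRefine_sfClass` (b₁, c₁ explicit) is the instantiation of `hfillS`∕`hfillG` by the crew's
theorems when they land (append-only v1.1 of this file).

HONEST FRAMING.  No printed sentence is a hypothesis; every crew object is imported BY NAME (`ApproxRefine`, `sfClass`,
`RegularSup`, `precomp`, `X0`, `fullFill`, `rootH`, `SkeletonDatum`, `Xfirst`, `plaqLog`, `covGrad`, `flux`, `SmallField`,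
`IsUnitaryCfg`, `IsPeriodicCfg`, `bavg`, `rescale`); no `def … : Prop` fact, no definition; no `sorry`; axioms ⊆
{propext, Classical.choice, Quot.sound}.  NE3 NOT proved; `ApproxRefine` here is CONDITIONAL on the two filling bounds;
every headline «NE3-(A) CONDITIONAL on (H1)(H3ˢᵘᵖ)(H0)»; spine 0/9; the cell's conditionals (`BetaPertH`, (B), G-an2-4)
occur nowhere here; finite T⁴ rung (B)+1 — NOT infinite volume, NOT a mass gap, NOT the Clay problem.  HONEST
DEPENDENCY (cell page 1): continuum YM on T⁴ ⇐ BetaPertH ∧ nine spine estimates (0/9 proved); BetaPertH ⇐ (D1) ∧ (D4) ∧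
CAP+tail; G-an2-4 gates asym, D1 and NE2/3/4.  PLACEMENT (human rule 2026-08-19): cell work under
`Summits/QuantumFields/BalabanUV/`; imports tree modules only; moves nothing.
-/

set_option autoImplicit false

open scoped BigOperators Matrix Matrix.Norms.L2Operator
open NormedSpace Finset

namespace Summit.QuantumFields.BalabanUV.T4Continuum.ApproxRefineAssembly

open Literature.MathematicalPhysics.QuantumFieldTheory.Balaban1983to89
open B7Prop1Explicit B7Prop2Explicit B7Prop1Local MatrixLog UnitaryModel
open T4AveragingDeficitWall hiding Site Plane Plaq Bond
open T4AveragingDeficitWallBoundary (IsPeriodicCfg)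
open AveragingDeficitTransport (norm_Ad_of_unitary mem_U1_of_unitary)
open AveragingDeficitNearIdentity (Ad_neg)
open MinimalActionRate (sfClass)
open MinimalActionRefine (RegularSup)
open SkeletonLattice SkeletonFill SkeletonFillUnitary SkeletonFillFull SkeletonPrecomp SkeletonPrecompTools
open BlockAverageLoopLogCore (plaqLog Xfirst norm_Xavg_sub_Xfirst_le)
open SmoothRefineOfApprox (ApproxRefine)
open ApproxRefineMismatch

noncomputable section

variable {d : ℕ} {n : Type*} [Fintype n] [DecidableEq n]

/-! ## §1 The filled pre-compensated configuration of a regular datum: structure -/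

/-- `T = precomp L U` of a class-`j` regular datum is a skeleton datum of radius `(8d−7)·b(L^j)^{−2}` on the coarse torus
of period `N·L^j`. [folklore] -/
theorem skeletonDatum_precomp_of_regularSup {L N : ℕ} (hL : 1 ≤ L) {b c : ℝ} (hb : 0 ≤ b) {j : ℕ}
    {U : B7Prop1Explicit.Site d → Fin d → (Matrix n n ℂ)ˣ} (hreg : RegularSup d L N b c j U)
    (hsmall : (8 * (d : ℝ) - 7) * (b / ((L : ℝ) ^ j) ^ 2) ≤ 1 / 4) :
    SkeletonDatum L ((N * L ^ j : ℕ) : ℤ) ((8 * (d : ℝ) - 7) * (b / ((L : ℝ) ^ j) ^ 2)) (precomp L U) :=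
  skeletonDatum_precomp hL hreg.unitary hreg.periodic (by positivity) hreg.small hsmall

/-- The filling `W = fullFill L T (rootH L T)` of a skeleton datum is unitary. [folklore] -/
theorem isUnitaryCfg_fullFill {L : ℕ} {P : ℤ} {a : ℝ} {T : B7Prop1Explicit.Site d → Fin d → (Matrix n n ℂ)ˣ}
    (hD : SkeletonDatum L P a T) : IsUnitaryCfg (fullFill L T (rootH L T)) := fun x μ =>
  fullFill_mem hD.unitary (fun z κ ν => rootH_mem_unitary hD.unitary z κ ν (hD.small_all z κ ν)) x μ

/-- The filling of a `P`-periodic skeleton datum is `L·P`-periodic. [folklore] -/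
theorem isPeriodicCfg_fullFill {L : ℕ} {P : ℤ} {a : ℝ} {T : B7Prop1Explicit.Site d → Fin d → (Matrix n n ℂ)ˣ}
    (hD : SkeletonDatum L P a T) : IsPeriodicCfg (fullFill L T (rootH L T)) ((L : ℤ) * P) := fun x κ μ =>
  fullFill_add_period hD.one_le (fun z κ' μ' => hD.periodic z κ' μ') (rootH_add_period hD.periodic L) x κ μ

/-! ## §2 The covariant-gradient hypothesis of the loop-log law from a `Plane`-oriented bound -/

/-- For unitary `W` with `SmallField W a`, `a ≤ 1/4`, a pointwise bound `g ≥ 0` on `covGrad W (flux W)` gives the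
`plaqLog`-oriented covariant-gradient hypothesis of `BlockAverageLoopLogCore.norm_Xavg_sub_Xfirst_le` with the same
`g` (for `m ≠ κ` this is leaf-01's `norm_covGrad_mlog_le`; for `m = κ` both logarithms vanish). [folklore] -/
theorem plaqLog_grad_le_of_covGrad {W : B7Prop1Explicit.Site d → Fin d → (Matrix n n ℂ)ˣ}
    {a g : ℝ} (hS : SmallField W a) (ha : a ≤ 1 / 4)
    (hg : ∀ (x : B7Prop1Explicit.Site d) (μ : Fin d) (π : T4AveragingDeficitWall.Plane d),
      ‖covGrad W (flux W) x μ π‖ ≤ g)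
    (hg0 : 0 ≤ g) (κ : Fin d) (x : B7Prop1Explicit.Site d) (μ m : Fin d) :
    ‖((W x μ : (Matrix n n ℂ)ˣ) : Matrix n n ℂ) * plaqLog W κ m (x + e μ) * (((W x μ)⁻¹ : (Matrix n n ℂ)ˣ) : Matrix n n ℂ)
        - plaqLog W κ m x‖ ≤ g := by
  by_cases hmκ : m = κ
  · subst hmκ
    have h0 : ∀ y : B7Prop1Explicit.Site d, plaqLog W m m y = 0 := fun y => by
      unfold plaqLog; rw [hol_plaqWord_self, Units.val_one, mlog_one]
    rw [h0, h0, mul_zero, zero_mul, sub_zero, norm_zero]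
    exact hg0
  · have h := norm_covGrad_mlog_le hS ha hg x μ hmκ
    unfold plaqLog
    exact h

/-! ## §3 Scale arithmetic (pure real inequalities, kept out of the main proof) -/

/-- The loop-log law's bound at level `j+1` in units of `(L^j)^{−3}`:
`20dL²(8(d+1)(d+4)L²·b₁/(L^{j+1})²)² + d(d+1)L³·c₁/(L^{j+1})³ ≤ (1280d(d+1)²(d+4)²L²b₁² + d(d+1)c₁)/(L^j)³`. [folklore] -/
theorem scale_E1 (d L j : ℕ) (hL : 1 ≤ L) (b₁ c₁ : ℝ) :
    20 * (d : ℝ) * (L : ℝ) ^ 2 * (8 * ((d : ℝ) + 1) * ((d : ℝ) + 4) * (L : ℝ) ^ 2 * (b₁ / ((L : ℝ) ^ (j + 1)) ^ 2)) ^ 2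
        + (d : ℝ) * ((d : ℝ) + 1) * (L : ℝ) ^ 3 * (c₁ / ((L : ℝ) ^ (j + 1)) ^ 3)
      ≤ (1280 * (d : ℝ) * ((d : ℝ) + 1) ^ 2 * ((d : ℝ) + 4) ^ 2 * (L : ℝ) ^ 2 * b₁ ^ 2
          + (d : ℝ) * ((d : ℝ) + 1) * c₁) / ((L : ℝ) ^ j) ^ 3 := by
  have hL1 : (1 : ℝ) ≤ L := by exact_mod_cast hL
  have hL0 : (0 : ℝ) < L := by linarith
  set s : ℝ := (L : ℝ) ^ j with hs
  have hs1 : 1 ≤ s := one_le_pow₀ hL1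
  have hs0 : 0 < s := by positivity
  have hsL : (L : ℝ) ^ (j + 1) = s * L := by rw [hs, pow_succ]
  rw [hsL]
  have e2 : (d : ℝ) * ((d : ℝ) + 1) * (L : ℝ) ^ 3 * (c₁ / (s * L) ^ 3) = (d : ℝ) * ((d : ℝ) + 1) * c₁ / s ^ 3 := by
    field_simp
  have e1 : 20 * (d : ℝ) * (L : ℝ) ^ 2 * (8 * ((d : ℝ) + 1) * ((d : ℝ) + 4) * (L : ℝ) ^ 2 * (b₁ / (s * L) ^ 2)) ^ 2
      = 1280 * (d : ℝ) * ((d : ℝ) + 1) ^ 2 * ((d : ℝ) + 4) ^ 2 * (L : ℝ) ^ 2 * b₁ ^ 2 / s ^ 4 := by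
    field_simp
    ring
  rw [e1, e2, add_div]
  have hkey : 1280 * (d : ℝ) * ((d : ℝ) + 1) ^ 2 * ((d : ℝ) + 4) ^ 2 * (L : ℝ) ^ 2 * b₁ ^ 2 / s ^ 4
      ≤ 1280 * (d : ℝ) * ((d : ℝ) + 1) ^ 2 * ((d : ℝ) + 4) ^ 2 * (L : ℝ) ^ 2 * b₁ ^ 2 / s ^ 3 := by
    apply div_le_div_of_nonneg_left (by positivity) (by positivity)
    calc s ^ 3 = s ^ 3 * 1 := (mul_one _).symm
      _ ≤ s ^ 3 * s := by gcongr
      _ = s ^ 4 := by ring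
  linarith

/-- The pre-compensation comparison at level `j` in units of `(L^j)^{−3}`: with `p = precompCoeff L ∈ [0, 1/2]`,
`D = d − 1 ≥ 0`, `a = b/(L^j)²`, `g = c/(L^j)³`:
`p·D·2(2pDg + 37(Da)² + 4a(Da)) ≤ D²(c + (37D + 4)b²)/(L^j)³`. [folklore] -/
theorem scale_X0 (L j : ℕ) (hL : 1 ≤ L) {D b c : ℝ} (hD : 0 ≤ D) (hb : 0 ≤ b) (hc : 0 ≤ c) :
    precompCoeff L * (D * (2 * (2 * (precompCoeff L * (D * (c / ((L : ℝ) ^ j) ^ 3)))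
        + 37 * (D * (b / ((L : ℝ) ^ j) ^ 2)) ^ 2 + 4 * (b / ((L : ℝ) ^ j) ^ 2) * (D * (b / ((L : ℝ) ^ j) ^ 2)))))
      ≤ D ^ 2 * (c + (37 * D + 4) * b ^ 2) / ((L : ℝ) ^ j) ^ 3 := by
  have hL1 : (1 : ℝ) ≤ L := by exact_mod_cast hL
  set s : ℝ := (L : ℝ) ^ j with hs
  have hs1 : 1 ≤ s := one_le_pow₀ hL1
  have hs0 : 0 < s := by positivity
  have hp0 : 0 ≤ precompCoeff L := precompCoeff_nonneg hL
  have hp : precompCoeff L ≤ 1 / 2 := precompCoeff_le_half hL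
  set p := precompCoeff L with hpdef
  -- `a² ≤ b²/s³`
  have ha2 : (b / s ^ 2) ^ 2 ≤ b ^ 2 / s ^ 3 := by
    rw [div_pow]
    have : s ^ 3 ≤ (s ^ 2) ^ 2 := by
      calc s ^ 3 = s ^ 3 * 1 := (mul_one _).symm
        _ ≤ s ^ 3 * s := by gcongr
        _ = (s ^ 2) ^ 2 := by ring
    exact div_le_div_of_nonneg_left (by positivity) (by positivity) this
  have h1 : 2 * (p * (D * (c / s ^ 3))) ≤ D * (c / s ^ 3) := by
    have h0 : 0 ≤ D * (c / s ^ 3) := by positivity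
    nlinarith
  have h2 : 37 * (D * (b / s ^ 2)) ^ 2 ≤ 37 * D ^ 2 * (b ^ 2 / s ^ 3) := by
    rw [mul_pow]; nlinarith [ha2, sq_nonneg D]
  have h3 : 4 * (b / s ^ 2) * (D * (b / s ^ 2)) ≤ 4 * D * (b ^ 2 / s ^ 3) := by
    have e : 4 * (b / s ^ 2) * (D * (b / s ^ 2)) = 4 * D * (b / s ^ 2) ^ 2 := by ring
    rw [e]; exact mul_le_mul_of_nonneg_left ha2 (by positivity)
  have hin0 : 0 ≤ 2 * (2 * (p * (D * (c / s ^ 3))) + 37 * (D * (b / s ^ 2)) ^ 2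
      + 4 * (b / s ^ 2) * (D * (b / s ^ 2))) := by positivity
  have hin : 2 * (2 * (p * (D * (c / s ^ 3))) + 37 * (D * (b / s ^ 2)) ^ 2 + 4 * (b / s ^ 2) * (D * (b / s ^ 2)))
      ≤ 2 * (D * (c / s ^ 3) + 37 * D ^ 2 * (b ^ 2 / s ^ 3) + 4 * D * (b ^ 2 / s ^ 3)) := by linarith
  calc p * (D * (2 * (2 * (p * (D * (c / s ^ 3))) + 37 * (D * (b / s ^ 2)) ^ 2
          + 4 * (b / s ^ 2) * (D * (b / s ^ 2)))))
      ≤ (1 / 2) * (D * (2 * (D * (c / s ^ 3) + 37 * D ^ 2 * (b ^ 2 / s ^ 3) + 4 * D * (b ^ 2 / s ^ 3)))) :=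
        mul_le_mul hp (mul_le_mul_of_nonneg_left hin hD) (by positivity) (by norm_num)
    _ = D ^ 2 * (c + (37 * D + 4) * b ^ 2) / s ^ 3 := by field_simp; ring

/-! ## §4 The END modulo the regularity bounds of the filling -/

/-- **LEAF R1 ASSEMBLED, MODULO THE REGULARITY OF THE FILLING.**  Let `L ≥ 1`, `b, c, b₁, c₁ ≥ 0` with the `j`-uniform
smallness conditions `(8d−7)b ≤ 1/16`, `(d−1)b ≤ 1/2`, `2·(((L−1)/(2L))(d−1)c) + 37((d−1)b)² + 4b((d−1)b) ≤ 1/4`,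
`512(d+1)(d+4)L²b₁ ≤ 1`.  Suppose that for every `j` and every `U ∈ sfClass L N ε j` with `RegularSup d L N b c j U` the
filled pre-compensated configuration `W = fullFill L (precomp L U) (rootH L (precomp L U))` satisfies
`SmallField W (b₁/(L^{j+1})²)` and `‖covGrad W (flux W) x κ π‖ ≤ c₁/(L^{j+1})³` everywhere.  Then
`ApproxRefine d (sfClass d L N ε) L N b c b₁ c₁ m` with
`m = 3·(1280·d(d+1)²(d+4)²L²·b₁² + d(d+1)·c₁ + (d−1)²·(c + (37(d−1) + 4)·b²))`: the refinement is `W` itself, unitary and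
`(N·L^{j+1})`-periodic by §1, with chain products `exp(−X₀ U)·U`, whose block average misses `U` by
`3·(‖X_c(W) − X¹_c(W)‖ + ‖X₀(T) − X₀(U)‖)` (part 1) — the first summand is leaf-08's loop-log law, the second the
first-order pre-compensated plaquette lemma. [folklore] -/
theorem approxRefine_of_fillBounds [Nonempty n] (hd1 : 1 ≤ d) (L N : ℕ) (hL : 1 ≤ L) {ε b c b₁ c₁ : ℝ}
    (hb : 0 ≤ b) (hc : 0 ≤ c)
    (hb₁ : 0 ≤ b₁) (hc₁ : 0 ≤ c₁)
    (h16 : (8 * (d : ℝ) - 7) * b ≤ 1 / 16) (hhalf : ((d : ℝ) - 1) * b ≤ 1 / 2)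
    (hquarter : 2 * (precompCoeff L * (((d : ℝ) - 1) * c)) + 37 * (((d : ℝ) - 1) * b) ^ 2
      + 4 * b * (((d : ℝ) - 1) * b) ≤ 1 / 4)
    (h512 : 512 * (d + 1) * (d + 4) * (L : ℝ) ^ 2 * b₁ ≤ 1)
    (hfillS : ∀ (j : ℕ) (U : B7Prop1Explicit.Site d → Fin d → (Matrix n n ℂ)ˣ), U ∈ sfClass (d := d) L N ε j →
      RegularSup d L N b c j U →
      SmallField (fullFill L (precomp L U) (rootH L (precomp L U))) (b₁ / ((L : ℝ) ^ (j + 1)) ^ 2))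
    (hfillG : ∀ (j : ℕ) (U : B7Prop1Explicit.Site d → Fin d → (Matrix n n ℂ)ˣ), U ∈ sfClass (d := d) L N ε j →
      RegularSup d L N b c j U → ∀ (x : B7Prop1Explicit.Site d) (κ : Fin d) (π : T4AveragingDeficitWall.Plane d),
      ‖covGrad (fullFill L (precomp L U) (rootH L (precomp L U)))
          (flux (fullFill L (precomp L U) (rootH L (precomp L U)))) x κ π‖ ≤ c₁ / ((L : ℝ) ^ (j + 1)) ^ 3) :
    ApproxRefine d (sfClass (d := d) (n := n) L N ε) L N b c b₁ c₁
      (3 * (1280 * d * ((d : ℝ) + 1) ^ 2 * ((d : ℝ) + 4) ^ 2 * (L : ℝ) ^ 2 * b₁ ^ 2 + d * ((d : ℝ) + 1) * c₁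
        + ((d : ℝ) - 1) ^ 2 * (c + (37 * ((d : ℝ) - 1) + 4) * b ^ 2))) := by
  intro j U hU hreg
  have hL1 : (1 : ℝ) ≤ L := by exact_mod_cast hL
  have hL0 : (0 : ℝ) < L := by linarith
  -- level quantities
  set s : ℝ := (L : ℝ) ^ j with hsdef
  have hs1 : 1 ≤ s := one_le_pow₀ hL1
  have hs0 : 0 < s := by positivity
  set a : ℝ := b / s ^ 2 with hadef
  set g : ℝ := c / s ^ 3 with hgdef
  have ha0 : 0 ≤ a := by positivity
  have hgn : 0 ≤ g := by positivity
  have hab : a ≤ b := div_le_self hb (one_le_pow₀ hs1)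
  have hgc : g ≤ c := div_le_self hc (one_le_pow₀ hs1)
  -- the datum `T` and the filling `W`
  set T := precomp L U with hTdef
  set W := fullFill L T (rootH L T) with hWdef
  have hUu : IsUnitaryCfg U := hU.1
  have hUs : SmallField U a := hreg.small
  have hUg : ∀ (x : B7Prop1Explicit.Site d) (κ : Fin d) (π : T4AveragingDeficitWall.Plane d),
      ‖covGrad U (flux U) x κ π‖ ≤ g := hreg.grad
  have h16j : (8 * (d : ℝ) - 7) * a ≤ 1 / 16 := by
    have h87 : 0 ≤ 8 * (d : ℝ) - 7 := by
      have : (1 : ℝ) ≤ d := by exact_mod_cast hd1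
      linarith
    exact (mul_le_mul_of_nonneg_left hab h87).trans h16
  have ha4 : a ≤ 1 / 4 := by
    have h87 : (1 : ℝ) ≤ 8 * (d : ℝ) - 7 := by
      have : (1 : ℝ) ≤ d := by exact_mod_cast hd1
      linarith
    nlinarith [h16j, ha0, h87]
  have hD : SkeletonDatum L ((N * L ^ j : ℕ) : ℤ) ((8 * (d : ℝ) - 7) * a) T :=
    skeletonDatum_precomp_of_regularSup hL hb hreg (by linarith)
  have hWu : IsUnitaryCfg W := isUnitaryCfg_fullFill hD
  have hWp : IsPeriodicCfg W ((N * L ^ (j + 1) : ℕ) : ℤ) := by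
    have h := isPeriodicCfg_fullFill hD
    have hper : ((L : ℤ) * ((N * L ^ j : ℕ) : ℤ)) = ((N * L ^ (j + 1) : ℕ) : ℤ) := by push_cast; ring
    rw [hper] at h
    exact h
  -- the regularity of the filling (hypotheses)
  have hWs : SmallField W (b₁ / ((L : ℝ) ^ (j + 1)) ^ 2) := hfillS j U hU hreg
  have hWg := hfillG j U hU hreg
  refine ⟨W, hWu, hWp, hWs, hWg, ?_⟩
  -- the mismatch
  intro z κ
  have hsL1 : 1 ≤ (L : ℝ) ^ (j + 1) := one_le_pow₀ hL1
  have haW0 : 0 ≤ b₁ / ((L : ℝ) ^ (j + 1)) ^ 2 := by positivity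
  have hgW0 : 0 ≤ c₁ / ((L : ℝ) ^ (j + 1)) ^ 3 := by positivity
  have haWb : b₁ / ((L : ℝ) ^ (j + 1)) ^ 2 ≤ b₁ := div_le_self hb₁ (one_le_pow₀ hsL1)
  have hsmallW : 512 * (d + 1) * (d + 4) * (L : ℝ) ^ 2 * (b₁ / ((L : ℝ) ^ (j + 1)) ^ 2) ≤ 1 :=
    (mul_le_mul_of_nonneg_left haWb (by positivity)).trans h512
  have hK : (4 : ℝ) ≤ 512 * (d + 1) * (d + 4) * (L : ℝ) ^ 2 := by
    have hd0 : (0 : ℝ) ≤ d := by positivity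
    have h1 : (1 : ℝ) ≤ (d : ℝ) + 1 := by linarith
    have h4 : (4 : ℝ) ≤ (d : ℝ) + 4 := by linarith
    have hL2 : (1 : ℝ) ≤ (L : ℝ) ^ 2 := one_le_pow₀ hL1
    calc (4 : ℝ) ≤ 512 * 1 * 4 * 1 := by norm_num
      _ ≤ 512 * ((d : ℝ) + 1) * ((d : ℝ) + 4) * (L : ℝ) ^ 2 := by gcongr
  have haW4 : b₁ / ((L : ℝ) ^ (j + 1)) ^ 2 ≤ 1 / 4 := by
    have : 4 * (b₁ / ((L : ℝ) ^ (j + 1)) ^ 2) ≤ 512 * (d + 1) * (d + 4) * (L : ℝ) ^ 2 * (b₁ / ((L : ℝ) ^ (j + 1)) ^ 2) :=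
      mul_le_mul_of_nonneg_right hK haW0
    linarith
  -- (E1): leaf-08's loop-log law for `W`
  have hWU1 : ∀ x κ', W x κ' ∈ U1 (Matrix n n ℂ) := fun x κ' => mem_U1_of_unitary (hWu x κ')
  have hE1 := norm_Xavg_sub_Xfirst_le L hL W hWU1 haW0 hgW0 hsmallW (fun x μ ν hμν => hWs x μ ν hμν)
    ((L : ℤ) • z) κ (plaqLog_grad_le_of_covGrad hWs haW4 hWg hgW0 κ)
  -- the two norm conditions of part 1
  have hθ : 8 * (d + 1) * (d + 4) * (L : ℝ) ^ 2 * (b₁ / ((L : ℝ) ^ (j + 1)) ^ 2) ≤ 1 / 64 := by linarith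
  have hA : ‖Xavg L W ((L : ℤ) • z) κ‖ ≤ 1 / 2 := hE1.2.trans (by linarith)
  have hd0 : 0 ≤ (d : ℝ) - 1 := by
    have : (1 : ℝ) ≤ d := by exact_mod_cast hd1
    linarith
  have hB : ‖X0 L U z κ‖ ≤ 1 / 2 := by
    have h := norm_X0_le hL hUs (by linarith) z κ
    exact h.trans ((mul_le_mul_of_nonneg_left hab hd0).trans hhalf)
  have hmis := norm_sub_rescale_bavg_fullFill_le hUu hD h16j z κ hA hB
  -- part 1 §2: `X₀(T) − X₀(U)`
  have hξ : ((d : ℝ) - 1) * a ≤ 1 / 2 := (mul_le_mul_of_nonneg_left hab hd0).trans hhalf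
  have hpc0 : 0 ≤ precompCoeff L := precompCoeff_nonneg hL
  have hquarter_j : 2 * (precompCoeff L * (((d : ℝ) - 1) * g)) + 37 * (((d : ℝ) - 1) * a) ^ 2
      + 4 * a * (((d : ℝ) - 1) * a) ≤ 1 / 4 := by
    have h1 : precompCoeff L * (((d : ℝ) - 1) * g) ≤ precompCoeff L * (((d : ℝ) - 1) * c) :=
      mul_le_mul_of_nonneg_left (mul_le_mul_of_nonneg_left hgc hd0) hpc0
    have h2 : (((d : ℝ) - 1) * a) ^ 2 ≤ (((d : ℝ) - 1) * b) ^ 2 :=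
      pow_le_pow_left₀ (by positivity) (mul_le_mul_of_nonneg_left hab hd0) 2
    have h3 : 4 * a * (((d : ℝ) - 1) * a) ≤ 4 * b * (((d : ℝ) - 1) * b) := by
      have := mul_le_mul hab (mul_le_mul_of_nonneg_left hab hd0) (by positivity) hb
      linarith
    linarith
  have hX0 := norm_X0_precomp_sub_X0_le hL hUu hUs ha4 hUg hξ hquarter_j z κ
  -- scale arithmetic
  have hS1 := scale_E1 d L j hL b₁ c₁
  have hS2 := scale_X0 L j hL hd0 hb hc
  rw [← hsdef] at hS1 hS2
  rw [← hadef, ← hgdef] at hS2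
  -- assemble
  calc ‖((U z κ : (Matrix n n ℂ)ˣ) : Matrix n n ℂ)
        - ((rescale L (bavg L W) z κ : (Matrix n n ℂ)ˣ) : Matrix n n ℂ)‖
      ≤ 3 * (‖Xavg L W ((L : ℤ) • z) κ - Xfirst L W ((L : ℤ) • z) κ‖ + ‖X0 L T z κ - X0 L U z κ‖) := hmis
    _ ≤ 3 * ((1280 * (d : ℝ) * ((d : ℝ) + 1) ^ 2 * ((d : ℝ) + 4) ^ 2 * (L : ℝ) ^ 2 * b₁ ^ 2
            + (d : ℝ) * ((d : ℝ) + 1) * c₁) / s ^ 3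
          + ((d : ℝ) - 1) ^ 2 * (c + (37 * ((d : ℝ) - 1) + 4) * b ^ 2) / s ^ 3) := by
        gcongr
        · exact hE1.1.trans hS1
        · exact hX0.trans hS2
    _ = _ := by ring

end

end Summit.QuantumFields.BalabanUV.T4Continuum.ApproxRefineAssembly
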